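import Literature.Analysis.Complex.CousinProblems
import Literature.NumberTheory.Transcendental.DolbeaultConvexProofs
import HarnessLib

/-!
# Cousin I on convex open subsets of `ℂⁿ`: `H¹(𝔘, 𝒪) = 0` for every open cover

K. Fritzsche, H. Grauert, *From Holomorphic Functions to Complex Manifolds* (2002), Ch. V §1
Prop. 1.6 with the Remark following it (the additive Cousin problem is solvable as soon as
`H¹(X, 𝒪) = 0`) and Ch. VI §2, proof of Thm. 2.9 (injectivity of `H¹(X, 𝒪) → H^{0,1}(X)`:
partition of unity, then a `∂̄`-correction); L. Hörmander, *An Introduction to Complex Analysis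
in Several Variables* (1973), Thm. 2.7.8 (`∂̄`-solvability on convex — indeed pseudoconvex —
open sets). The tree's `CousinProblems.exists_holomorphic_cochain_of_cocycle` is the case
`Ω = ℂ^ι`; here the same proof is run on an arbitrary CONVEX OPEN `Ω ⊆ ℂ^ι`, with the
`∂̄`-equation solved by `exists_dbar_potential_of_convex` (`DolbeaultConvexProofs`) and the
partition of unity taken on the open submanifold `Ω`:

* `exists_smooth_cochain_of_cocycle_of_isOpen` — smooth solution `φ_k = Σ_m ρ_m c_{km}` for an
  open cover `(U_k)` of an OPEN set `Ω` (any open `Ω`, no convexity);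
* `exists_holomorphic_cochain_of_smooth_of_convex` — the `∂̄`-correction on a convex open `Ω`;
* `exists_holomorphic_cochain_of_cocycle_of_convex` — **Cousin I on a convex open `Ω`**: every
  holomorphic `1`-cocycle on every open cover of `Ω` is a coboundary, `Ȟ¹(𝔘, 𝒪) = 0`.

This is the degree-one "Theorem B" for convex domains that patches local solutions of division
and extension problems on chart-convex Čech sets (regular-sequence and extension steps of the
hyperplane-section bookkeeping of Serre's theorem A for line bundles).

Everything is proved; theorems only.

## References

* K. Fritzsche, H. Grauert, *From Holomorphic Functions to Complex Manifolds*, GTM 213 (2002),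
  Ch. V §1 Prop. 1.6, Ch. VI §2 Thm. 2.9 (proof). [FritzscheGrauert2002]
* L. Hörmander, *An Introduction to Complex Analysis in Several Variables* (1973), Thm. 2.7.8.
  [HormanderSCV1973]
-/

noncomputable section

open Complex Set Filter Function TopologicalSpace
open scoped Topology Manifold ContDiff

namespace Literature.Analysis.Complex

variable {ι : Type*} [Fintype ι] [DecidableEq ι] {κ : Type*}

omit [DecidableEq ι] in
/-- **The smooth solution of the additive Cousin problem on an open set** (Fritzsche–Grauert,
proof of VI.2.9: `φ_k = ∑_m ρ_m c_{km}` for a smooth partition of unity `(ρ_m)` of the open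
submanifold `Ω`, subordinate to the cover): for an open cover `(U_k)` of an open `Ω ⊆ ℂ^ι` and
holomorphic `c_{kl}` on `U_k ∩ U_l` with `c_{kl} + c_{lm} = c_{km}` on triple overlaps there are
`φ_k`, real-`C^∞` on `U_k`, with `φ_k - φ_l = c_{kl}` on `U_k ∩ U_l`.
[cite: FritzscheGrauert2002, Ch. VI §2 (proof of Thm. 2.9)] -/
theorem exists_smooth_cochain_of_cocycle_of_isOpen {Ω : Set (ι → ℂ)} (hΩ : IsOpen Ω)
    (U : κ → Set (ι → ℂ)) (hU : ∀ k, IsOpen (U k)) (hUΩ : ∀ k, U k ⊆ Ω)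
    (hcov : ∀ x ∈ Ω, ∃ k, x ∈ U k) (c : κ → κ → (ι → ℂ) → ℂ)
    (hc : ∀ k l, DifferentiableOn ℂ (c k l) (U k ∩ U l))
    (hcyc : ∀ k l m, ∀ x ∈ U k ∩ U l ∩ U m, c k l x + c l m x = c k m x) :
    ∃ φ : κ → (ι → ℂ) → ℂ, (∀ k, ContDiffOn ℝ ∞ (φ k) (U k)) ∧
      ∀ k l, ∀ x ∈ U k ∩ U l, φ k x - φ l x = c k l x := by
  have hsub : ∀ k l m, ∀ x ∈ U k ∩ U l ∩ U m, c k m x - c l m x = c k l x :=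
    fun k l m x hx ↦ by linear_combination (-1 : ℂ) * hcyc k l m x hx
  -- the open submanifold `Ω`
  set Ω' : Opens (ι → ℂ) := ⟨Ω, hΩ⟩ with hΩ'
  haveI : LocallyCompactSpace Ω' := hΩ.locallyCompactSpace
  -- a smooth partition of unity on `Ω'` subordinate to the pulled-back cover
  obtain ⟨ρ, hρ⟩ := SmoothPartitionOfUnity.exists_isSubordinate 𝓘(ℝ, ι → ℂ) (M := Ω')
    isClosed_univ (fun k ↦ Subtype.val ⁻¹' U k) (fun k ↦ (hU k).preimage continuous_subtype_val)
    fun y _ ↦ mem_iUnion.2 (hcov y y.2)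
  have hfin : ∀ y : Ω', (fun m ↦ ρ m y).HasFiniteSupport := fun y ↦
    (ρ.locallyFinite.point_finite y).subset fun _ hm ↦ hm
  -- the cochain on the submanifold and its extension by zero
  set ψ : κ → Ω' → ℂ := fun k y ↦ ∑ᶠ m, ρ m y • c k m y with hψ
  refine ⟨fun k ↦ Function.extend Subtype.val (ψ k) 0, fun k x hx ↦ ?_, fun k l x hx ↦ ?_⟩
  · -- smoothness on `U_k`: on the submanifold, then through `contMDiffAt_subtype_iff`
    have hxΩ : x ∈ Ω := hUΩ k hx
    have h1 : ContMDiffAt 𝓘(ℝ, ι → ℂ) 𝓘(ℝ, ℂ) ∞ (ψ k) ⟨x, hxΩ⟩ := by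
      refine ρ.contMDiffAt_finsum (fun m hm ↦ ?_)
      have hxm : x ∈ U m := hρ m hm
      have ho : IsOpen (U k ∩ U m) := (hU k).inter (hU m)
      have h2 : ContDiffAt ℝ ∞ (c k m) x :=
        ((SCV.contDiffOn_infty (hc k m) ho).restrict_scalars ℝ).contDiffAt (ho.mem_nhds ⟨hx, hxm⟩)
      have h3 : ContMDiffAt 𝓘(ℝ, ι → ℂ) 𝓘(ℝ, ℂ) ∞ (c k m) x := contMDiffAt_iff_contDiffAt.2 h2
      exact contMDiffAt_subtype_iff.2 h3
    have h4 : ContMDiffAt 𝓘(ℝ, ι → ℂ) 𝓘(ℝ, ℂ) ∞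
        (fun y : Ω' ↦ Function.extend Subtype.val (ψ k) 0 y) ⟨x, hxΩ⟩ := by
      have hfun : (fun y : Ω' ↦ Function.extend Subtype.val (ψ k) 0 y) = ψ k :=
        funext fun y ↦ Subtype.val_injective.extend_apply (ψ k) 0 y
      rw [hfun]
      exact h1
    exact (contMDiffAt_iff_contDiffAt.1 (contMDiffAt_subtype_iff.1 h4)).contDiffWithinAt
  · -- `φ_k - φ_l = ∑_m ρ_m (c_{km} - c_{lm}) = ∑_m ρ_m c_{kl} = c_{kl}`
    have hxΩ : x ∈ Ω := hUΩ k hx.1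
    change Function.extend Subtype.val (ψ k) 0 x - Function.extend Subtype.val (ψ l) 0 x = c k l x
    rw [show Function.extend Subtype.val (ψ k) 0 x = ψ k ⟨x, hxΩ⟩ from
        Subtype.val_injective.extend_apply (ψ k) 0 ⟨x, hxΩ⟩,
      show Function.extend Subtype.val (ψ l) 0 x = ψ l ⟨x, hxΩ⟩ from
        Subtype.val_injective.extend_apply (ψ l) 0 ⟨x, hxΩ⟩]
    change ∑ᶠ m, ρ m ⟨x, hxΩ⟩ • c k m x - ∑ᶠ m, ρ m ⟨x, hxΩ⟩ • c l m x = c k l x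
    have hfk : (fun m ↦ ρ m ⟨x, hxΩ⟩ • c k m x).HasFiniteSupport :=
      (hfin ⟨x, hxΩ⟩).smul_left fun m ↦ c k m x
    have hfl : (fun m ↦ ρ m ⟨x, hxΩ⟩ • c l m x).HasFiniteSupport :=
      (hfin ⟨x, hxΩ⟩).smul_left fun m ↦ c l m x
    rw [← finsum_sub_distrib hfk hfl]
    have h1 : ∀ m, ρ m ⟨x, hxΩ⟩ • c k m x - ρ m ⟨x, hxΩ⟩ • c l m x = ρ m ⟨x, hxΩ⟩ • c k l x :=
      fun m ↦ by
      by_cases hm : ρ m ⟨x, hxΩ⟩ = 0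
      · simp [hm]
      · have hxm : x ∈ U m := hρ m (subset_tsupport _ hm)
        rw [← smul_sub, hsub k l m x ⟨hx, hxm⟩]
    rw [finsum_congr h1, ← finsum_smul, ρ.sum_eq_one (mem_univ _), one_smul]

/-- Every `0`-form has pointwise type `(0,0)` (local copy of the lemma of `PolyhedronApprox`).
[folklore] -/
private theorem isOfTypeAt_fin_zero' {E : Type*} [NormedAddCommGroup E] [NormedSpace ℂ E]
    (η : E [⋀^Fin 0]→L[ℝ] ℂ) : IsOfTypeAt 0 0 η :=
  ⟨rfl, fun θ v ↦ by
    have h : (fun i ↦ exp (θ * I) • v i) = v := Subsingleton.elim _ _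
    rw [h]
    simp⟩

/-- **The `∂̄`-correction on a convex open set** (Fritzsche–Grauert, proof of VI.2.9; Hörmander
2.7.8 for the `∂̄`-equation): if the holomorphic cocycle `(c_{kl})` on the open cover `(U_k)` of
the convex open `Ω ⊆ ℂ^ι` is the coboundary of a cochain `(φ_k)` of functions real-`C^∞` on
`U_k`, then it is the coboundary of a HOLOMORPHIC cochain: the `∂̄φ_k` glue to a `∂̄`-closed
`(0,1)`-form `ω` smooth on `Ω`, `∂̄β = ω` is solvable on `Ω` (`exists_dbar_potential_of_convex`),
and `h_k = φ_k - β` is holomorphic with `h_k - h_l = c_{kl}`.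
[cite: FritzscheGrauert2002, Ch. VI §2 (proof of Thm. 2.9)] -/
theorem exists_holomorphic_cochain_of_smooth_of_convex {Ω : Set (ι → ℂ)} (hΩo : IsOpen Ω)
    (hΩc : Convex ℝ Ω) (U : κ → Set (ι → ℂ)) (hU : ∀ k, IsOpen (U k)) (hUΩ : ∀ k, U k ⊆ Ω)
    (hcov : ∀ x ∈ Ω, ∃ k, x ∈ U k) (c : κ → κ → (ι → ℂ) → ℂ)
    (hc : ∀ k l, DifferentiableOn ℂ (c k l) (U k ∩ U l)) (φ : κ → (ι → ℂ) → ℂ)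
    (hφ : ∀ k, ContDiffOn ℝ ∞ (φ k) (U k))
    (hφc : ∀ k l, ∀ x ∈ U k ∩ U l, φ k x - φ l x = c k l x) :
    ∃ h : κ → (ι → ℂ) → ℂ, (∀ k, DifferentiableOn ℂ (h k) (U k)) ∧
      ∀ k l, ∀ x ∈ U k ∩ U l, h k x - h l x = c k l x := by
  classical
  rcases isEmpty_or_nonempty κ with hκ | hκ
  · exact ⟨fun k ↦ isEmptyElim k, fun k ↦ isEmptyElim k, fun k ↦ isEmptyElim k⟩
  -- the `0`-forms `F_k` and a pointwise choice of chart index on `Ω`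
  set F : κ → (ι → ℂ) → (ι → ℂ) [⋀^Fin 0]→L[ℝ] ℂ := fun k ↦ zeroForm (φ k) with hF
  have hFs : ∀ k, ContDiffOn ℝ ∞ (F k) (U k) := fun k ↦ contDiffOn_zeroForm (hφ k)
  have hFd : ∀ k, ∀ x ∈ U k, DifferentiableAt ℝ (F k) x := fun k x hx ↦
    ((hFs k).differentiableOn (by simp)).differentiableAt ((hU k).mem_nhds hx)
  have hcov' : ∀ x, ∃ k, x ∈ Ω → x ∈ U k := fun x ↦ by
    by_cases hx : x ∈ Ω
    · obtain ⟨k, hk⟩ := hcov x hx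
      exact ⟨k, fun _ ↦ hk⟩
    · exact ⟨Classical.arbitrary κ, fun h ↦ (hx h).elim⟩
  set kx : (ι → ℂ) → κ := fun x ↦ Classical.choose (hcov' x) with hkx
  have hkx_mem : ∀ x ∈ Ω, x ∈ U (kx x) := fun x hx ↦ Classical.choose_spec (hcov' x) hx
  -- the `(0,1)`-form `θ = ∂̄φ_k` on `U_k`
  set θ : (ι → ℂ) → (ι → ℂ) [⋀^Fin (0 + 1)]→L[ℝ] ℂ :=
    fun x ↦ typeProjAt 0 (0 + 1) (extDeriv (F (kx x)) x) with hθ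
  -- `θ = ∂̄φ_k` on EVERY `U_k ∋ x` (the `φ_k` differ by holomorphic functions)
  have hloc : ∀ k x, x ∈ U k → θ x = typeProjAt 0 (0 + 1) (extDeriv (F k) x) := by
    intro k x hx
    have hx' : x ∈ U (kx x) := hkx_mem x (hUΩ k hx)
    have hev : F (kx x) =ᶠ[𝓝 x] fun y ↦ F k y + zeroForm (c (kx x) k) y := by
      filter_upwards [((hU (kx x)).inter (hU k)).mem_nhds ⟨hx', hx⟩] with y hy
      simp only [hF]
      rw [← zeroForm_add_apply]
      simp only [zeroForm]
      congr 1
      linear_combination hφc (kx x) k y hy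
    have hdc : DifferentiableAt ℂ (zeroForm (c (kx x) k)) x :=
      differentiableAt_zeroForm
        ((hc (kx x) k).differentiableAt (((hU (kx x)).inter (hU k)).mem_nhds ⟨hx', hx⟩))
    simp only [hθ]
    rw [extDeriv_congr_of_eventuallyEq hev, extDeriv_add_apply (hFd k x hx)
      (hdc.restrictScalars ℝ), typeProjAt_add, typeProjAt_zero_one_extDeriv_eq_zero hdc, add_zero]
  -- near each point of `Ω`, `θ = (dG)^{0,1}` for a GLOBALLY smooth `0`-form `G` (cut-off of `F_k`)
  have hθG : ∀ x₀ ∈ Ω, ∃ G : (ι → ℂ) → (ι → ℂ) [⋀^Fin 0]→L[ℝ] ℂ, ContDiff ℝ ∞ G ∧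
      θ =ᶠ[𝓝 x₀] fun x ↦ typeProjAt 0 (0 + 1) (extDeriv G x) := by
    intro x₀ hx₀
    set k := kx x₀ with hk
    obtain ⟨χ, hχs, -, hχU, O, hOo, hxO, hO1⟩ := exists_complex_cutoff_nhdsSet
      (isCompact_singleton : IsCompact ({x₀} : Set (ι → ℂ))) (hU k)
      (singleton_subset_iff.2 (hkx_mem x₀ hx₀))
    have hx₀O : x₀ ∈ O := hxO (mem_singleton x₀)
    refine ⟨fun x ↦ χ x • F k x, contDiff_smul_of_tsupport_subset (hU k) hχs hχU (hFs k), ?_⟩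
    filter_upwards [hOo.mem_nhds hx₀O, (hU k).mem_nhds (hkx_mem x₀ hx₀)] with x hxO' hxU
    have hev : F k =ᶠ[𝓝 x] fun y ↦ χ y • F k y := by
      filter_upwards [hOo.mem_nhds hxO'] with y hy
      rw [hO1 y hy, one_smul]
    rw [hloc k x hxU, extDeriv_congr_of_eventuallyEq hev]
  have hθs : ContDiffOn ℝ ∞ θ Ω := fun x₀ hx₀ ↦ by
    obtain ⟨G, hG, hθG'⟩ := hθG x₀ hx₀
    exact ((contDiff_typeProjAt_extDeriv 0 (0 + 1) hG).contDiffAt.congr_of_eventuallyEq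
      hθG').contDiffWithinAt
  have hθt : ∀ x ∈ Ω, IsOfTypeAt 0 (0 + 1) (θ x) := fun x _ ↦ isOfTypeAt_typeProjAt rfl _
  have hθc : ∀ x ∈ Ω, typeProjAt 0 (0 + 2) (extDeriv θ x) = 0 := fun x₀ hx₀ ↦ by
    obtain ⟨G, hG, hθG'⟩ := hθG x₀ hx₀
    rw [extDeriv_congr_of_eventuallyEq hθG']
    exact dbar_dbar_eq_zero (p := 0) (q := 0) (fun y ↦ isOfTypeAt_fin_zero' (G y)) hG x₀
  -- solve `∂̄β = θ` on the convex open `Ω`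
  obtain ⟨β, hβs, -, hβθ⟩ :=
    Literature.NumberTheory.Transcendental.exists_dbar_potential_of_convex hΩo hΩc (n := 0) (p := 0) (q := 0)
    hθs hθt hθc
  have hβd : ∀ x ∈ Ω, DifferentiableAt ℝ β x := fun x hx ↦
    ((hβs.differentiableOn (by simp)).differentiableAt (hΩo.mem_nhds hx))
  -- `h_k = φ_k - β()` is holomorphic on `U_k`
  refine ⟨fun k x ↦ φ k x - evalZeroForm (β x), fun k ↦ ?_, fun k l x hx ↦ by
    rw [← hφc k l x hx]; ring⟩
  have hδ : DifferentiableOn ℂ (fun x ↦ evalZeroForm (F k x - β x)) (U k) := by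
    refine differentiableOn_evalZeroForm_of_dbar_eq_zero (F := fun x ↦ F k x - β x) (hU k)
      (fun x hx ↦ ((hFd k x hx).sub (hβd x (hUΩ k hx))).differentiableWithinAt) fun x hx ↦ ?_
    rw [extDeriv_sub_apply (hFd k x hx) (hβd x (hUΩ k hx)), typeProjAt_sub, ← hloc k x hx,
      hβθ x (hUΩ k hx), sub_self]
  refine hδ.congr fun x _ ↦ ?_
  simp [hF]

/-- **Cousin I on a convex open set: `H¹(𝔘, 𝒪) = 0` for every open cover `𝔘` of a convex
open `Ω ⊆ ℂ^ι`.** For an open cover `(U_k)_{k ∈ κ}` of `Ω` and holomorphic `c_{kl}` on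
`U_k ∩ U_l` with `c_{kl} + c_{lm} = c_{km}` on `U_k ∩ U_l ∩ U_m` there are holomorphic `h_k` on
`U_k` with `c_{kl} = h_k - h_l` on `U_k ∩ U_l` (Fritzsche–Grauert V.1.6 with the Remark after it:
only `H¹(Ω, 𝒪) = 0` is used, supplied by `H^{0,1}_{∂̄}(Ω) = 0` for convex `Ω`, Hörmander 2.7.8).
[cite: FritzscheGrauert2002, Ch. V §1 Prop. 1.6 and Ch. VI §2 Thm. 2.9] -/
theorem exists_holomorphic_cochain_of_cocycle_of_convex {Ω : Set (ι → ℂ)} (hΩo : IsOpen Ω)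
    (hΩc : Convex ℝ Ω) (U : κ → Set (ι → ℂ)) (hU : ∀ k, IsOpen (U k)) (hUΩ : ∀ k, U k ⊆ Ω)
    (hcov : ∀ x ∈ Ω, ∃ k, x ∈ U k) (c : κ → κ → (ι → ℂ) → ℂ)
    (hc : ∀ k l, DifferentiableOn ℂ (c k l) (U k ∩ U l))
    (hcyc : ∀ k l m, ∀ x ∈ U k ∩ U l ∩ U m, c k l x + c l m x = c k m x) :
    ∃ h : κ → (ι → ℂ) → ℂ, (∀ k, DifferentiableOn ℂ (h k) (U k)) ∧
      ∀ k l, ∀ x ∈ U k ∩ U l, c k l x = h k x - h l x := by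
  obtain ⟨φ, hφ, hφc⟩ := exists_smooth_cochain_of_cocycle_of_isOpen hΩo U hU hUΩ hcov c hc hcyc
  obtain ⟨h, hh, hhc⟩ :=
    exists_holomorphic_cochain_of_smooth_of_convex hΩo hΩc U hU hUΩ hcov c hc φ hφ hφc
  exact ⟨h, hh, fun k l x hx ↦ (hhc k l x hx).symm⟩

end Literature.Analysis.Complex
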